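import Summits.QuantumFields.YangMills.Theorems.BalabanLadderNTReferenceThreePointNoE2
import HarnessLib

/-!
# Seam `UVSeamRec` (stmt-QuantumFields-20043), conjunct 3 of `stub_floorsEngine` without E2-osc — COLLAR FORM of the
# three-point ceiling: E3-osc is needed only at lattice depth `≥ κ/aβ` (the physical collar)

Helper file (`--supports stmt-QuantumFields-20043`; owner R78: seam currency №1, THREE-POINT CONJUNCT supplier) of the
fleet lead prover of crux `NT` (unit `ym-spine-19353-p1`, g5); route-independent.  CLAUSE SERVED: conjunct 3 of the
registered v4-F `stub_floorsEngine`.  Same statements as `…NTReferenceThreePointNoE2.lean` (p520541) with the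
three-point exterior-oscillation ceiling E3-osc assumed ONLY where the transfer reads it — at depth `≥ κ/aβ` in femto
cubes (g4's collar shape, `…NTReferenceTorusCollar.lean`) — while E1-osc keeps its registered «depth ≥ 1» form (the
E2-free pair bound `BoundaryLaw.kerCov_osc_of_e1osc` needs it at the centres of sub-cubes of every radius `≤ κ/aβ`;
small depths only cost constant inflation, cf. `BoundaryLaw.fbl_of_largeDepth`).  So the minimal ceiling bill for the
three-point conjunct reads: E1-osc (all depths, `C₁/d⁴`) + E3-osc in the physical collar.

* `triple_transfer_torus_noE2_collar3`, **`q3_floor_of_torusReference_noE2_collar3`**,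
  `threePointConjunct_of_torusReference_noE2_collar3`, `threePointConjunct_of_torusSigned_noE2_collar3`.

Refs: ENGINE-TARGET v4.3 (evidence on stmt-QuantumFields-19353 / -20043); `Cruxes/UVSeamRec/Lines/birth.lean`.
-/

set_option autoImplicit false

noncomputable section

open scoped SchwartzMap
open MeasureTheory Filter Topology
open Literature.MathematicalPhysics.QuantumFieldTheory Literature.MathematicalPhysics.QuantumLattice
open Literature.Probability.LatticeModels
open Summit.QuantumFields.YangMills.Cruxes.OSLegsFromFemtoAndGap.DlrCollarTransfer
open Summit.QuantumFields.YangMills.Theorems.OSLegsFromFemtoAndGap.StubLower (siteToE_sub)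
open Summit.QuantumFields.YangMills.Cruxes.NT.BoundaryLaw (kerCov_osc_of_e1osc)

namespace Summit.QuantumFields.YangMills.Cruxes.NT.Reference

/-! ## §1 The per-triple transfer without E2-osc, E3-osc in the physical collar only -/

section Torus

variable (G : Type) [Group G] [TopologicalSpace G] [IsTopologicalGroup G] [CompactSpace G]
  [MeasurableSpace G] [BorelSpace G] (r : LatticeRep G)

/-- **Per-triple transfer at coupling `β` from E1-osc ∧ E3-osc-in-the-collar** (E3 assumed only at depth `≥ κ/α`).  Transfer cube of radius `RP`,
femto at `β`, inside two tori `2L+1`, `2L'+1`; sites `x, y, z` of depth `≥ κ/α` (`≥ 1`), pairwise `16 ≤ ‖·‖ ≤ κ/α`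
apart: `|torusK3_L(x,y,z) − torusK3_{L'}(x,y,z)| ≤ 2 (k w′_{yz} + k w′_{xz} + k w′_{xy} + k³) + ω₃` with `k = C₁(α/κ)⁴`,
`w′_{pq} = 8·8⁸C₁²/‖q−p‖⁸`, `ω₃ = C₃(α/κ)⁴/(1 + min sep)⁸`. [folklore] -/
theorem triple_transfer_torus_noE2_collar3 (β : ℝ) {C₁ C₃ ℓ κ α : ℝ} (hC₁ : 0 ≤ C₁) (hC₃ : 0 ≤ C₃) (hκ : 0 < κ)
    (hα : 0 < α) {RP L L' : ℕ} (hfem : ((2 * RP + 1 : ℕ) : ℝ) * α ≤ ℓ)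
    (hL : 2 * RP + 1 + 3 ≤ 2 * L + 1) (hL' : 2 * RP + 1 + 3 ≤ 2 * L' + 1)
    (H1 : ∀ (c : Fin 4 → ℤ) (b : ℕ), (b : ℝ) * α ≤ ℓ → ∀ (η η' : LGConfig 4 G) (x : Fin 4 → ℤ), 1 ≤ depth c b x →
      |kerE G r β c b η (dens G r x) - kerE G r β c b η' (dens G r x)| ≤ C₁ / (depth c b x : ℝ) ^ 4)
    (H3 : ∀ (c : Fin 4 → ℤ) (b : ℕ), (b : ℝ) * α ≤ ℓ → ∀ (η η' : LGConfig 4 G) (x y z : Fin 4 → ℤ),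
      κ / α ≤ (depth c b x : ℝ) → κ / α ≤ (depth c b y : ℝ) → κ / α ≤ (depth c b z : ℝ) →
        |kerK3 G r β c b η x y z - kerK3 G r β c b η' x y z| ≤
          C₃ / ((min (min (depth c b x) (depth c b y)) (depth c b z) : ℕ) : ℝ) ^ 4 /
            (1 + min (min ‖siteToE (y - x)‖ ‖siteToE (z - y)‖) ‖siteToE (z - x)‖) ^ 8)
    {x y z : Fin 4 → ℤ}
    (hx : κ / α ≤ (depth (fun _ => -(RP : ℤ)) (2 * RP + 1) x : ℝ) ∧ 1 ≤ depth (fun _ => -(RP : ℤ)) (2 * RP + 1) x)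
    (hy : κ / α ≤ (depth (fun _ => -(RP : ℤ)) (2 * RP + 1) y : ℝ) ∧ 1 ≤ depth (fun _ => -(RP : ℤ)) (2 * RP + 1) y)
    (hz : κ / α ≤ (depth (fun _ => -(RP : ℤ)) (2 * RP + 1) z : ℝ) ∧ 1 ≤ depth (fun _ => -(RP : ℤ)) (2 * RP + 1) z)
    (hxy : (16 : ℝ) ≤ ‖siteToE (y - x)‖) (hxz : (16 : ℝ) ≤ ‖siteToE (z - x)‖)
    (hyz : (16 : ℝ) ≤ ‖siteToE (z - y)‖)
    (hxy' : ‖siteToE (y - x)‖ ≤ κ / α) (hxz' : ‖siteToE (z - x)‖ ≤ κ / α) (hyz' : ‖siteToE (z - y)‖ ≤ κ / α) :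
    |torusK3 G r β L x y z - torusK3 G r β L' x y z| ≤
      2 * ((C₁ * (α / κ) ^ 4) * (8 * 8 ^ 8 * C₁ ^ 2 / ‖siteToE (z - y)‖ ^ 8) +
            (C₁ * (α / κ) ^ 4) * (8 * 8 ^ 8 * C₁ ^ 2 / ‖siteToE (z - x)‖ ^ 8) +
            (C₁ * (α / κ) ^ 4) * (8 * 8 ^ 8 * C₁ ^ 2 / ‖siteToE (y - x)‖ ^ 8) +
            (C₁ * (α / κ) ^ 4) * (C₁ * (α / κ) ^ 4) * (C₁ * (α / κ) ^ 4)) +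
        C₃ * (α / κ) ^ 4 / (1 + min (min ‖siteToE (y - x)‖ ‖siteToE (z - y)‖) ‖siteToE (z - x)‖) ^ 8 := by
  obtain ⟨hxκ, hx1⟩ := hx
  obtain ⟨hyκ, hy1⟩ := hy
  obtain ⟨hzκ, hz1⟩ := hz
  have hfem' : ((2 * RP + 1 : ℕ) : ℝ) * α ≤ ℓ := hfem
  have ho : ∀ {u : Fin 4 → ℤ}, κ / α ≤ (depth (fun _ => -(RP : ℤ)) (2 * RP + 1) u : ℝ) →
      1 ≤ depth (fun _ => -(RP : ℤ)) (2 * RP + 1) u →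
      ∀ ζ ζ', |kerE G r β (fun _ => -(RP : ℤ)) (2 * RP + 1) ζ (dens G r u) -
        kerE G r β (fun _ => -(RP : ℤ)) (2 * RP + 1) ζ' (dens G r u)| ≤ C₁ * (α / κ) ^ 4 :=
    fun huκ hu1 ζ ζ' => (H1 _ _ hfem' ζ ζ' _ hu1).trans (div_pow_depth_le hC₁ hκ hα huκ)
  have hw : ∀ {p q : Fin 4 → ℤ}, κ / α ≤ (depth (fun _ => -(RP : ℤ)) (2 * RP + 1) p : ℝ) →
      κ / α ≤ (depth (fun _ => -(RP : ℤ)) (2 * RP + 1) q : ℝ) →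
      (16 : ℝ) ≤ ‖siteToE (q - p)‖ → ‖siteToE (q - p)‖ ≤ κ / α →
      ∀ ζ ζ', |kerCov G r β (fun _ => -(RP : ℤ)) (2 * RP + 1) ζ (dens G r p) (dens G r q) -
        kerCov G r β (fun _ => -(RP : ℤ)) (2 * RP + 1) ζ' (dens G r p) (dens G r q)| ≤
        8 * 8 ^ 8 * C₁ ^ 2 / ‖siteToE (q - p)‖ ^ 8 :=
    fun hpκ hqκ hn hνκ ζ ζ' => kerCov_osc_of_e1osc G r β hC₁ hα H1 hfem' ζ ζ' _ _ hn (hνκ.trans hpκ) (hνκ.trans hqκ)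
  have hpos3 : 0 < (1 + min (min ‖siteToE (y - x)‖ ‖siteToE (z - y)‖) ‖siteToE (z - x)‖) ^ 8 := by positivity
  have hmin3 : κ / α ≤ ((min (min (depth (fun _ => -(RP : ℤ)) (2 * RP + 1) x)
      (depth (fun _ => -(RP : ℤ)) (2 * RP + 1) y)) (depth (fun _ => -(RP : ℤ)) (2 * RP + 1) z) : ℕ) : ℝ) := by
    rw [Nat.cast_min, Nat.cast_min]; exact le_min (le_min hxκ hyκ) hzκ
  have ho3 : ∀ ζ ζ', |kerK3 G r β (fun _ => -(RP : ℤ)) (2 * RP + 1) ζ x y z -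
      kerK3 G r β (fun _ => -(RP : ℤ)) (2 * RP + 1) ζ' x y z| ≤
      C₃ * (α / κ) ^ 4 / (1 + min (min ‖siteToE (y - x)‖ ‖siteToE (z - y)‖) ‖siteToE (z - x)‖) ^ 8 :=
    fun ζ ζ' => (H3 _ _ hfem' ζ ζ' x y z hxκ hyκ hzκ).trans
      (div_le_div_of_nonneg_right (div_pow_depth_le hC₃ hκ hα hmin3) hpos3.le)
  exact abs_torusK3_sub_torusK3_le G r β _ _ L L' hL hL' hx1 hy1 hz1 (ho hxκ hx1) (ho hyκ hy1) (ho hzκ hz1)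
    (hw hyκ hzκ hyz hyz') (hw hxκ hzκ hxz hxz') (hw hxκ hyκ hxy hxy') ho3

/-! ## §2 The three-point floor on every torus, without E2-osc, collar form of E3-osc -/

/-- **`|Q3| ≥ ε` on every large torus from E1-osc ∧ E3-osc (depth `≥ κ/aβ` only) ∧ a floor with margin `M₃′` on ONE torus per coupling**
(explicit witnesses).  `a > 0`, `a → 0`; `C₁, C₃ ≥ 0`; `σ > 0`, `2σ ≤ κ`, `2(σ+κ) < ℓ`; E1-osc, E3-osc; test functions
`f, g, h` with pairwise disjoint supports in the ball of radius `σ`; for `β ≥ β₅` one torus `2L₀(β)+1` with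
`aβ·L₀(β) ≥ σ+κ+1` on which `|Q3_{β,L₀(β)}(f,g,h)| ≥ ε + M₃′(β)`, `M₃′` the E2-free per-triple margin summed against
`|f||g||h|`.  Then, eventually in `β`, `|Q3_{β,L}(f,g,h)| ≥ ε` on every torus `2L+1` with `aβ·L ≥ σ+κ+1`. [folklore] -/
theorem q3_floor_of_torusReference_noE2_collar3 (a : ℝ → ℝ) (ha₀ : ∀ β, 0 < a β) (ha : Tendsto a atTop (𝓝 0))
    {C₁ C₃ ℓ σ κ : ℝ} (hC₁ : 0 ≤ C₁) (hC₃ : 0 ≤ C₃) (hσ : 0 < σ) (hσκ : 2 * σ ≤ κ) (hℓ : 2 * (σ + κ) < ℓ)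
    (hE1 : ∃ β₁ : ℝ, ∀ β : ℝ, β₁ ≤ β → ∀ (c : Fin 4 → ℤ) (b : ℕ), (b : ℝ) * a β ≤ ℓ →
      ∀ (η η' : LGConfig 4 G) (x : Fin 4 → ℤ), 1 ≤ depth c b x →
        |kerE G r β c b η (dens G r x) - kerE G r β c b η' (dens G r x)| ≤ C₁ / (depth c b x : ℝ) ^ 4)
    (hE3 : ∃ β₃ : ℝ, ∀ β : ℝ, β₃ ≤ β → ∀ (c : Fin 4 → ℤ) (b : ℕ), (b : ℝ) * a β ≤ ℓ →
      ∀ (η η' : LGConfig 4 G) (x y z : Fin 4 → ℤ),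
        κ / a β ≤ (depth c b x : ℝ) → κ / a β ≤ (depth c b y : ℝ) → κ / a β ≤ (depth c b z : ℝ) →
        |kerK3 G r β c b η x y z - kerK3 G r β c b η' x y z| ≤
          C₃ / ((min (min (depth c b x) (depth c b y)) (depth c b z) : ℕ) : ℝ) ^ 4 /
            (1 + min (min ‖siteToE (y - x)‖ ‖siteToE (z - y)‖) ‖siteToE (z - x)‖) ^ 8)
    (f g h : 𝓢(EuclideanSpace ℝ (Fin 4), ℝ)) (ε β₅ : ℝ) (L₀ : ℝ → ℕ)
    (hfg : Disjoint (tsupport (f : EuclideanSpace ℝ (Fin 4) → ℝ)) (tsupport (g : EuclideanSpace ℝ (Fin 4) → ℝ)))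
    (hgh : Disjoint (tsupport (g : EuclideanSpace ℝ (Fin 4) → ℝ)) (tsupport (h : EuclideanSpace ℝ (Fin 4) → ℝ)))
    (hfh : Disjoint (tsupport (f : EuclideanSpace ℝ (Fin 4) → ℝ)) (tsupport (h : EuclideanSpace ℝ (Fin 4) → ℝ)))
    (hfσ : tsupport (f : EuclideanSpace ℝ (Fin 4) → ℝ) ⊆ Metric.closedBall 0 σ)
    (hgσ : tsupport (g : EuclideanSpace ℝ (Fin 4) → ℝ) ⊆ Metric.closedBall 0 σ)
    (hhσ : tsupport (h : EuclideanSpace ℝ (Fin 4) → ℝ) ⊆ Metric.closedBall 0 σ)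
    (HR : ∀ β : ℝ, β₅ ≤ β → σ + κ + 1 ≤ a β * L₀ β ∧
      ε + ∑ x ∈ box 4 (L₀ β), ∑ y ∈ box 4 (L₀ β), ∑ z ∈ box 4 (L₀ β),
          |f (a β • siteToE x)| * |g (a β • siteToE y)| * |h (a β • siteToE z)| *
            (2 * ((C₁ * (a β / κ) ^ 4) * (8 * 8 ^ 8 * C₁ ^ 2 / ‖siteToE (z - y)‖ ^ 8) +
                  (C₁ * (a β / κ) ^ 4) * (8 * 8 ^ 8 * C₁ ^ 2 / ‖siteToE (z - x)‖ ^ 8) +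
                  (C₁ * (a β / κ) ^ 4) * (8 * 8 ^ 8 * C₁ ^ 2 / ‖siteToE (y - x)‖ ^ 8) +
                  (C₁ * (a β / κ) ^ 4) * (C₁ * (a β / κ) ^ 4) * (C₁ * (a β / κ) ^ 4)) +
              C₃ * (a β / κ) ^ 4 / (1 + min (min ‖siteToE (y - x)‖ ‖siteToE (z - y)‖) ‖siteToE (z - x)‖) ^ 8) ≤
        |Q3 G r β (L₀ β) (a β) f g h|) :
    ∃ β₅' : ℝ, ∀ β : ℝ, β₅' ≤ β → ∀ L : ℕ, σ + κ + 1 ≤ a β * L → ε ≤ |Q3 G r β L (a β) f g h| := by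
  obtain ⟨β₁, H1⟩ := hE1
  obtain ⟨β₃, H3⟩ := hE3
  have hκ : 0 < κ := by linarith
  -- separations of the three disjoint support pairs
  obtain ⟨δ₁, hδ₁, S₁⟩ := exists_sep_of_disjoint_tsupport hfg hfσ
  obtain ⟨δ₂, hδ₂, S₂⟩ := exists_sep_of_disjoint_tsupport hfh hfσ
  obtain ⟨δ₃, hδ₃, S₃⟩ := exists_sep_of_disjoint_tsupport hgh hgσ
  set δ₀ : ℝ := min (min δ₁ δ₂) δ₃ with hδ₀
  have hδ₀pos : 0 < δ₀ := lt_min (lt_min hδ₁ hδ₂) hδ₃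
  have hδ : 0 < min (min (1 / 4 : ℝ) ((ℓ - 2 * (σ + κ)) / 5)) (δ₀ / 16) :=
    lt_min (lt_min (by norm_num) (by linarith)) (by linarith)
  obtain ⟨βa, Ha⟩ := eventually_le_of_tendsto ha hδ
  refine ⟨max (max β₅ βa) (max β₁ β₃), fun β hβ L hL => ?_⟩
  have hβ₅ : β₅ ≤ β := le_trans (le_max_left _ _) (le_trans (le_max_left _ _) hβ)
  have hβa : βa ≤ β := le_trans (le_max_right _ _) (le_trans (le_max_left _ _) hβ)
  have hβ₁ : β₁ ≤ β := le_trans (le_max_left _ _) (le_trans (le_max_right _ _) hβ)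
  have hβ₃ : β₃ ≤ β := le_trans (le_max_right _ _) (le_trans (le_max_right _ _) hβ)
  have hα : 0 < a β := ha₀ β
  have hsmall := Ha β hβa
  have h4 : a β ≤ 1 / 4 := hsmall.trans ((min_le_left _ _).trans (min_le_left _ _))
  have hℓ' : a β ≤ (ℓ - 2 * (σ + κ)) / 5 := hsmall.trans ((min_le_left _ _).trans (min_le_right _ _))
  have h16 : a β ≤ δ₀ / 16 := hsmall.trans (min_le_right _ _)
  have hρ' : a β ≤ ((σ + κ + 2 * a β) - σ - κ) / 2 := by linarith
  obtain ⟨hL₀, HRβ⟩ := HR β hβ₅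
  obtain ⟨-, hfem, hLL, hNL, -, hdep⟩ := scales hα hσ hκ h4 hρ' hℓ' hL (RP := ⌈(σ + κ) / a β⌉₊ + 1) rfl
  obtain ⟨-, -, hLL₀, hNL₀, -, -⟩ := scales hα hσ hκ h4 hρ' hℓ' hL₀ (RP := ⌈(σ + κ) / a β⌉₊ + 1) rfl
  set N := ⌈σ / a β⌉₊ with hN
  have hf0 : ∀ x, x ∉ box 4 N → f (a β • siteToE x) = 0 := fun x hx => apply_smul_siteToE_eq_zero hα hfσ hx
  have hg0 : ∀ y, y ∉ box 4 N → g (a β • siteToE y) = 0 := fun y hy => apply_smul_siteToE_eq_zero hα hgσ hy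
  have hh0 : ∀ z, z ∉ box 4 N → h (a β • siteToE z) = 0 := fun z hz => apply_smul_siteToE_eq_zero hα hhσ hz
  -- lattice separation of a cross-support pair: `16 ≤ ‖q − p‖ ≤ κ / aβ`
  have sep_lo : ∀ {v w : 𝓢(EuclideanSpace ℝ (Fin 4), ℝ)} {δ : ℝ}, δ₀ ≤ δ →
      (∀ p q : EuclideanSpace ℝ (Fin 4), v p ≠ 0 → w q ≠ 0 → δ ≤ ‖p - q‖) →
      ∀ {p q : Fin 4 → ℤ}, v (a β • siteToE p) ≠ 0 → w (a β • siteToE q) ≠ 0 →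
        (16 : ℝ) ≤ ‖siteToE (q - p)‖ := by
    intro v w δ hδδ S p q hp hq
    have h1 := S _ _ hp hq
    rw [norm_sub_rev, norm_smul_siteToE_sub (a β) hα p q] at h1
    have h2 : δ₀ ≤ a β * ‖siteToE (q - p)‖ := hδδ.trans h1
    have h3 : 16 * a β ≤ δ₀ := by linarith
    nlinarith [norm_nonneg (siteToE (q - p)), hα]
  have sep_hi : ∀ {v w : 𝓢(EuclideanSpace ℝ (Fin 4), ℝ)},
      tsupport (v : EuclideanSpace ℝ (Fin 4) → ℝ) ⊆ Metric.closedBall 0 σ →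
      tsupport (w : EuclideanSpace ℝ (Fin 4) → ℝ) ⊆ Metric.closedBall 0 σ →
      ∀ {p q : Fin 4 → ℤ}, v (a β • siteToE p) ≠ 0 → w (a β • siteToE q) ≠ 0 →
        ‖siteToE (q - p)‖ ≤ κ / a β := by
    intro v w hv hw p q hp hq
    have h1 := norm_siteToE_le_of_apply_ne_zero hα hv hp
    have h2 := norm_siteToE_le_of_apply_ne_zero hα hw hq
    rw [siteToE_sub]
    calc ‖siteToE q - siteToE p‖ ≤ ‖siteToE q‖ + ‖siteToE p‖ := norm_sub_le _ _
      _ ≤ σ / a β + σ / a β := add_le_add h2 h1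
      _ = 2 * σ / a β := by ring
      _ ≤ κ / a β := div_le_div_of_nonneg_right hσκ hα.le
  have htriple : ∀ x ∈ box 4 N, ∀ y ∈ box 4 N, ∀ z ∈ box 4 N,
      f (a β • siteToE x) ≠ 0 → g (a β • siteToE y) ≠ 0 → h (a β • siteToE z) ≠ 0 →
      |torusK3 G r β L x y z - torusK3 G r β (L₀ β) x y z| ≤
      2 * ((C₁ * (a β / κ) ^ 4) * (8 * 8 ^ 8 * C₁ ^ 2 / ‖siteToE (z - y)‖ ^ 8) +
            (C₁ * (a β / κ) ^ 4) * (8 * 8 ^ 8 * C₁ ^ 2 / ‖siteToE (z - x)‖ ^ 8) +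
            (C₁ * (a β / κ) ^ 4) * (8 * 8 ^ 8 * C₁ ^ 2 / ‖siteToE (y - x)‖ ^ 8) +
            (C₁ * (a β / κ) ^ 4) * (C₁ * (a β / κ) ^ 4) * (C₁ * (a β / κ) ^ 4)) +
        C₃ * (a β / κ) ^ 4 / (1 + min (min ‖siteToE (y - x)‖ ‖siteToE (z - y)‖) ‖siteToE (z - x)‖) ^ 8 :=
    fun x hx y hy z hz hfx hgy hhz =>
      triple_transfer_torus_noE2_collar3 G r β hC₁ hC₃ hκ hα hfem hLL hLL₀ (H1 β hβ₁) (H3 β hβ₃) (hdep x hx) (hdep y hy)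
        (hdep z hz) (sep_lo ((min_le_left _ _).trans (min_le_left _ _)) S₁ hfx hgy)
        (sep_lo ((min_le_left _ _).trans (min_le_right _ _)) S₂ hfx hhz) (sep_lo (min_le_right _ _) S₃ hgy hhz)
        (sep_hi hfσ hgσ hfx hgy) (sep_hi hfσ hhσ hfx hhz) (sep_hi hgσ hhσ hgy hhz)
  have eQ : ∀ M : ℕ, N ≤ M → Q3 G r β M (a β) f g h = ∑ x ∈ box 4 N, ∑ y ∈ box 4 N, ∑ z ∈ box 4 N,
      f (a β • siteToE x) * g (a β • siteToE y) * h (a β • siteToE z) * torusK3 G r β M x y z := fun M hM => by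
    unfold Q3
    exact sum_box₃_eq hM _ (fun x hx y z => by rw [hf0 x hx]; ring) (fun y hy x z => by rw [hg0 y hy]; ring)
      (fun z hz x y => by rw [hh0 z hz]; ring)
  have eM : ∑ x ∈ box 4 (L₀ β), ∑ y ∈ box 4 (L₀ β), ∑ z ∈ box 4 (L₀ β),
      |f (a β • siteToE x)| * |g (a β • siteToE y)| * |h (a β • siteToE z)| *
        (2 * ((C₁ * (a β / κ) ^ 4) * (8 * 8 ^ 8 * C₁ ^ 2 / ‖siteToE (z - y)‖ ^ 8) +
              (C₁ * (a β / κ) ^ 4) * (8 * 8 ^ 8 * C₁ ^ 2 / ‖siteToE (z - x)‖ ^ 8) +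
              (C₁ * (a β / κ) ^ 4) * (8 * 8 ^ 8 * C₁ ^ 2 / ‖siteToE (y - x)‖ ^ 8) +
              (C₁ * (a β / κ) ^ 4) * (C₁ * (a β / κ) ^ 4) * (C₁ * (a β / κ) ^ 4)) +
          C₃ * (a β / κ) ^ 4 / (1 + min (min ‖siteToE (y - x)‖ ‖siteToE (z - y)‖) ‖siteToE (z - x)‖) ^ 8) =
      ∑ x ∈ box 4 N, ∑ y ∈ box 4 N, ∑ z ∈ box 4 N,
      |f (a β • siteToE x)| * |g (a β • siteToE y)| * |h (a β • siteToE z)| *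
        (2 * ((C₁ * (a β / κ) ^ 4) * (8 * 8 ^ 8 * C₁ ^ 2 / ‖siteToE (z - y)‖ ^ 8) +
              (C₁ * (a β / κ) ^ 4) * (8 * 8 ^ 8 * C₁ ^ 2 / ‖siteToE (z - x)‖ ^ 8) +
              (C₁ * (a β / κ) ^ 4) * (8 * 8 ^ 8 * C₁ ^ 2 / ‖siteToE (y - x)‖ ^ 8) +
              (C₁ * (a β / κ) ^ 4) * (C₁ * (a β / κ) ^ 4) * (C₁ * (a β / κ) ^ 4)) +
          C₃ * (a β / κ) ^ 4 / (1 + min (min ‖siteToE (y - x)‖ ‖siteToE (z - y)‖) ‖siteToE (z - x)‖) ^ 8) :=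
    sum_box₃_eq hNL₀ _ (fun x hx y z => by rw [hf0 x hx, abs_zero]; ring)
      (fun y hy x z => by rw [hg0 y hy, abs_zero]; ring) (fun z hz x y => by rw [hh0 z hz, abs_zero]; ring)
  have hsum := abs_sum₃_sub_sum₃_le_of_ne (box 4 N) (fun x => f (a β • siteToE x)) (fun y => g (a β • siteToE y))
    (fun z => h (a β • siteToE z)) (fun x y z => torusK3 G r β L x y z)
    (fun x y z => torusK3 G r β (L₀ β) x y z) _ htriple
  rw [eQ (L₀ β) hNL₀, eM] at HRβ
  rw [eQ L hNL]
  have tri := abs_sub_abs_le_abs_sub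
    (∑ x ∈ box 4 N, ∑ y ∈ box 4 N, ∑ z ∈ box 4 N,
      f (a β • siteToE x) * g (a β • siteToE y) * h (a β • siteToE z) * torusK3 G r β (L₀ β) x y z)
    (∑ x ∈ box 4 N, ∑ y ∈ box 4 N, ∑ z ∈ box 4 N,
      f (a β • siteToE x) * g (a β • siteToE y) * h (a β • siteToE z) * torusK3 G r β L x y z)
  rw [abs_sub_comm] at hsum
  linarith [hsum, HRβ, tri]

/-- **Conjunct 3 of `stub_floorsEngine` WITHOUT E2-osc** (unsigned one-torus floor (R3′)); general `(G, r, a)`. [folklore] -/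
theorem threePointConjunct_of_torusReference_noE2_collar3 (a : ℝ → ℝ) (ha₀ : ∀ β, 0 < a β) (ha : Tendsto a atTop (𝓝 0))
    {C₁ C₃ ℓ σ κ : ℝ} (hC₁ : 0 ≤ C₁) (hC₃ : 0 ≤ C₃) (hσ : 0 < σ) (hσκ : 2 * σ ≤ κ) (hℓ : 2 * (σ + κ) < ℓ)
    (hE1 : ∃ β₁ : ℝ, ∀ β : ℝ, β₁ ≤ β → ∀ (c : Fin 4 → ℤ) (b : ℕ), (b : ℝ) * a β ≤ ℓ →
      ∀ (η η' : LGConfig 4 G) (x : Fin 4 → ℤ), 1 ≤ depth c b x →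
        |kerE G r β c b η (dens G r x) - kerE G r β c b η' (dens G r x)| ≤ C₁ / (depth c b x : ℝ) ^ 4)
    (hE3 : ∃ β₃ : ℝ, ∀ β : ℝ, β₃ ≤ β → ∀ (c : Fin 4 → ℤ) (b : ℕ), (b : ℝ) * a β ≤ ℓ →
      ∀ (η η' : LGConfig 4 G) (x y z : Fin 4 → ℤ),
        κ / a β ≤ (depth c b x : ℝ) → κ / a β ≤ (depth c b y : ℝ) → κ / a β ≤ (depth c b z : ℝ) →
        |kerK3 G r β c b η x y z - kerK3 G r β c b η' x y z| ≤
          C₃ / ((min (min (depth c b x) (depth c b y)) (depth c b z) : ℕ) : ℝ) ^ 4 /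
            (1 + min (min ‖siteToE (y - x)‖ ‖siteToE (z - y)‖) ‖siteToE (z - x)‖) ^ 8)
    (hR3 : ∃ (f g h : 𝓢(EuclideanSpace ℝ (Fin 4), ℝ)) (ε β₅ : ℝ) (L₀ : ℝ → ℕ),
      Disjoint (tsupport (f : EuclideanSpace ℝ (Fin 4) → ℝ)) (tsupport (g : EuclideanSpace ℝ (Fin 4) → ℝ)) ∧
      Disjoint (tsupport (g : EuclideanSpace ℝ (Fin 4) → ℝ)) (tsupport (h : EuclideanSpace ℝ (Fin 4) → ℝ)) ∧
      Disjoint (tsupport (f : EuclideanSpace ℝ (Fin 4) → ℝ)) (tsupport (h : EuclideanSpace ℝ (Fin 4) → ℝ)) ∧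
      tsupport (f : EuclideanSpace ℝ (Fin 4) → ℝ) ⊆ Metric.closedBall 0 σ ∧
      tsupport (g : EuclideanSpace ℝ (Fin 4) → ℝ) ⊆ Metric.closedBall 0 σ ∧
      tsupport (h : EuclideanSpace ℝ (Fin 4) → ℝ) ⊆ Metric.closedBall 0 σ ∧ 0 < ε ∧
      ∀ β : ℝ, β₅ ≤ β → σ + κ + 1 ≤ a β * L₀ β ∧
        ε + ∑ x ∈ box 4 (L₀ β), ∑ y ∈ box 4 (L₀ β), ∑ z ∈ box 4 (L₀ β),
            |f (a β • siteToE x)| * |g (a β • siteToE y)| * |h (a β • siteToE z)| *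
              (2 * ((C₁ * (a β / κ) ^ 4) * (8 * 8 ^ 8 * C₁ ^ 2 / ‖siteToE (z - y)‖ ^ 8) +
                    (C₁ * (a β / κ) ^ 4) * (8 * 8 ^ 8 * C₁ ^ 2 / ‖siteToE (z - x)‖ ^ 8) +
                    (C₁ * (a β / κ) ^ 4) * (8 * 8 ^ 8 * C₁ ^ 2 / ‖siteToE (y - x)‖ ^ 8) +
                    (C₁ * (a β / κ) ^ 4) * (C₁ * (a β / κ) ^ 4) * (C₁ * (a β / κ) ^ 4)) +
                C₃ * (a β / κ) ^ 4 / (1 + min (min ‖siteToE (y - x)‖ ‖siteToE (z - y)‖) ‖siteToE (z - x)‖) ^ 8) ≤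
          |Q3 G r β (L₀ β) (a β) f g h|) :
    ∃ (f g h : 𝓢(EuclideanSpace ℝ (Fin 4), ℝ)) (ε β₅ Λ₅ : ℝ),
      HasCompactSupport (f : EuclideanSpace ℝ (Fin 4) → ℝ) ∧
      HasCompactSupport (g : EuclideanSpace ℝ (Fin 4) → ℝ) ∧
      HasCompactSupport (h : EuclideanSpace ℝ (Fin 4) → ℝ) ∧
      Disjoint (tsupport (f : EuclideanSpace ℝ (Fin 4) → ℝ)) (tsupport (g : EuclideanSpace ℝ (Fin 4) → ℝ)) ∧
      Disjoint (tsupport (g : EuclideanSpace ℝ (Fin 4) → ℝ)) (tsupport (h : EuclideanSpace ℝ (Fin 4) → ℝ)) ∧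
      Disjoint (tsupport (f : EuclideanSpace ℝ (Fin 4) → ℝ)) (tsupport (h : EuclideanSpace ℝ (Fin 4) → ℝ)) ∧
      0 < ε ∧ ∀ β : ℝ, β₅ ≤ β → ∀ L : ℕ, Λ₅ ≤ a β * L → ε ≤ |Q3 G r β L (a β) f g h| := by
  obtain ⟨f, g, h, ε, β₅, L₀, hfg, hgh, hfh, hfσ, hgσ, hhσ, hε, HR⟩ := hR3
  obtain ⟨β₇, H⟩ := q3_floor_of_torusReference_noE2_collar3 G r a ha₀ ha hC₁ hC₃ hσ hσκ hℓ hE1 hE3 f g h ε β₅ L₀ hfg hgh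
    hfh hfσ hgσ hhσ HR
  exact ⟨f, g, h, ε, β₇, σ + κ + 1,
    (isCompact_closedBall (0 : EuclideanSpace ℝ (Fin 4)) σ).of_isClosed_subset (isClosed_tsupport _) hfσ,
    (isCompact_closedBall (0 : EuclideanSpace ℝ (Fin 4)) σ).of_isClosed_subset (isClosed_tsupport _) hgσ,
    (isCompact_closedBall (0 : EuclideanSpace ℝ (Fin 4)) σ).of_isClosed_subset (isClosed_tsupport _) hhσ,
    hfg, hgh, hfh, hε, H⟩

/-- **Conjunct 3 of `stub_floorsEngine` WITHOUT E2-osc from the SIGNED one-torus floor** `Q3 ≤ −(ε + M₃′)`. [folklore] -/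
theorem threePointConjunct_of_torusSigned_noE2_collar3 (a : ℝ → ℝ) (ha₀ : ∀ β, 0 < a β) (ha : Tendsto a atTop (𝓝 0))
    {C₁ C₃ ℓ σ κ : ℝ} (hC₁ : 0 ≤ C₁) (hC₃ : 0 ≤ C₃) (hσ : 0 < σ) (hσκ : 2 * σ ≤ κ) (hℓ : 2 * (σ + κ) < ℓ)
    (hE1 : ∃ β₁ : ℝ, ∀ β : ℝ, β₁ ≤ β → ∀ (c : Fin 4 → ℤ) (b : ℕ), (b : ℝ) * a β ≤ ℓ →
      ∀ (η η' : LGConfig 4 G) (x : Fin 4 → ℤ), 1 ≤ depth c b x →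
        |kerE G r β c b η (dens G r x) - kerE G r β c b η' (dens G r x)| ≤ C₁ / (depth c b x : ℝ) ^ 4)
    (hE3 : ∃ β₃ : ℝ, ∀ β : ℝ, β₃ ≤ β → ∀ (c : Fin 4 → ℤ) (b : ℕ), (b : ℝ) * a β ≤ ℓ →
      ∀ (η η' : LGConfig 4 G) (x y z : Fin 4 → ℤ),
        κ / a β ≤ (depth c b x : ℝ) → κ / a β ≤ (depth c b y : ℝ) → κ / a β ≤ (depth c b z : ℝ) →
        |kerK3 G r β c b η x y z - kerK3 G r β c b η' x y z| ≤
          C₃ / ((min (min (depth c b x) (depth c b y)) (depth c b z) : ℕ) : ℝ) ^ 4 /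
            (1 + min (min ‖siteToE (y - x)‖ ‖siteToE (z - y)‖) ‖siteToE (z - x)‖) ^ 8)
    (hR3s : ∃ (f g h : 𝓢(EuclideanSpace ℝ (Fin 4), ℝ)) (ε β₅ : ℝ) (L₀ : ℝ → ℕ),
      Disjoint (tsupport (f : EuclideanSpace ℝ (Fin 4) → ℝ)) (tsupport (g : EuclideanSpace ℝ (Fin 4) → ℝ)) ∧
      Disjoint (tsupport (g : EuclideanSpace ℝ (Fin 4) → ℝ)) (tsupport (h : EuclideanSpace ℝ (Fin 4) → ℝ)) ∧
      Disjoint (tsupport (f : EuclideanSpace ℝ (Fin 4) → ℝ)) (tsupport (h : EuclideanSpace ℝ (Fin 4) → ℝ)) ∧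
      tsupport (f : EuclideanSpace ℝ (Fin 4) → ℝ) ⊆ Metric.closedBall 0 σ ∧
      tsupport (g : EuclideanSpace ℝ (Fin 4) → ℝ) ⊆ Metric.closedBall 0 σ ∧
      tsupport (h : EuclideanSpace ℝ (Fin 4) → ℝ) ⊆ Metric.closedBall 0 σ ∧ 0 < ε ∧
      ∀ β : ℝ, β₅ ≤ β → σ + κ + 1 ≤ a β * L₀ β ∧
        Q3 G r β (L₀ β) (a β) f g h ≤
          -(ε + ∑ x ∈ box 4 (L₀ β), ∑ y ∈ box 4 (L₀ β), ∑ z ∈ box 4 (L₀ β),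
            |f (a β • siteToE x)| * |g (a β • siteToE y)| * |h (a β • siteToE z)| *
              (2 * ((C₁ * (a β / κ) ^ 4) * (8 * 8 ^ 8 * C₁ ^ 2 / ‖siteToE (z - y)‖ ^ 8) +
                    (C₁ * (a β / κ) ^ 4) * (8 * 8 ^ 8 * C₁ ^ 2 / ‖siteToE (z - x)‖ ^ 8) +
                    (C₁ * (a β / κ) ^ 4) * (8 * 8 ^ 8 * C₁ ^ 2 / ‖siteToE (y - x)‖ ^ 8) +
                    (C₁ * (a β / κ) ^ 4) * (C₁ * (a β / κ) ^ 4) * (C₁ * (a β / κ) ^ 4)) +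
                C₃ * (a β / κ) ^ 4 / (1 + min (min ‖siteToE (y - x)‖ ‖siteToE (z - y)‖) ‖siteToE (z - x)‖) ^ 8))) :
    ∃ (f g h : 𝓢(EuclideanSpace ℝ (Fin 4), ℝ)) (ε β₅ Λ₅ : ℝ),
      HasCompactSupport (f : EuclideanSpace ℝ (Fin 4) → ℝ) ∧
      HasCompactSupport (g : EuclideanSpace ℝ (Fin 4) → ℝ) ∧
      HasCompactSupport (h : EuclideanSpace ℝ (Fin 4) → ℝ) ∧
      Disjoint (tsupport (f : EuclideanSpace ℝ (Fin 4) → ℝ)) (tsupport (g : EuclideanSpace ℝ (Fin 4) → ℝ)) ∧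
      Disjoint (tsupport (g : EuclideanSpace ℝ (Fin 4) → ℝ)) (tsupport (h : EuclideanSpace ℝ (Fin 4) → ℝ)) ∧
      Disjoint (tsupport (f : EuclideanSpace ℝ (Fin 4) → ℝ)) (tsupport (h : EuclideanSpace ℝ (Fin 4) → ℝ)) ∧
      0 < ε ∧ ∀ β : ℝ, β₅ ≤ β → ∀ L : ℕ, Λ₅ ≤ a β * L → ε ≤ |Q3 G r β L (a β) f g h| := by
  obtain ⟨f, g, h, ε, β₅, L₀, hfg, hgh, hfh, hfσ, hgσ, hhσ, hε, HR⟩ := hR3s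
  refine threePointConjunct_of_torusReference_noE2_collar3 G r a ha₀ ha hC₁ hC₃ hσ hσκ hℓ hE1 hE3
    ⟨f, g, h, ε, β₅, L₀, hfg, hgh, hfh, hfσ, hgσ, hhσ, hε, fun β hβ => ?_⟩
  obtain ⟨hL₀, hs⟩ := HR β hβ
  exact ⟨hL₀, le_abs.2 (Or.inr (by linarith))⟩

end Torus

end Summit.QuantumFields.YangMills.Cruxes.NT.Reference

end
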